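import Summits.BirchSwinnertonDyer.Rank1Residual.Additive.N10LowerHalfStatements
import Literature.NumberTheory.EllipticCurves.Wuthrich2014.ShaBoundProofs
import HarnessLib

/-!
# Class N10 — E3 TRANSPORT by ISOGENY (Cassels): the lower half, and `BSD(E,p)` on the reducible
# semistable-twist rows, from ONE `ℚ`-isogenous curve with `p ∤ #Ш_an` (cell `b2b-bsdres`, lane
# CLASS-CLOSURE, seat cc-typer-2, team n1011 sub-target T-N10, experiment type E3)

HONEST FRAMING (cell `b2b-bsdres`, run/shared/lean/b2b/bsd-rank1-residual/, verbatim in every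
file): the goal of the cell is to DELETE the COMBINATION-SHAPED residual classes of the
Birch–Swinnerton-Dyer formula for ALL analytic-rank `≤ 1` elliptic curves over `ℚ` — "full BSD
formula for every rank `≤ 1` curve in class `C`" assembled STRICTLY from published theorems — so
that the rank-`≤ 1` remainder becomes exactly the CONSTRUCTION-SHAPED classes, which are TYPED
(missing-input `Prop`s), NOT attempted. This is not "finishing BSD". Lane CLASS-CLOSURE: research
routes, no claim beyond the stated classes; census output = EVIDENCE, never a Literature fact;
per-curve certificates are instrumentation only; N10 stays CONSTRUCTION; NOTHING is booked. Theorems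
only (no definition, no named fact); every published input is an explicit named-fact binder.

## What this file proves (E3 of CLASS-CLOSURE-PLAN §3.2: "isogeny (Cassels: BSD truth is
isogeny-invariant) … record the comparison statement each would need → candidate TRANSPORT LEMMAS")

The LOWER half `ord_p #Ш_an ≤ ord_p #Ш` of class N10 has content only on the rows with
`p ∣ #Ш_an(E)` (`N10.missingLowerBoundAt_of_padicValRat_le_zero`). `#Ш_an` is NOT an isogeny
invariant: along a `ℚ`-isogeny `E → E'` of degree divisible by `p` (an X3 row: `E[p]` reducible, a
rational `p`-isogeny exists) the `p`-part of `#Ш_an` changes by the `p`-parts of the period,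
Tamagawa and torsion ratios (Cassels 1965). But Miller's `BSD(E,p)` IS an isogeny invariant in
analytic rank `≤ 1` (tree: `Wuthrich2014.bsdp_of_isIsogenous`, Cassels' invariance of the BSD
quotient as the named fact `WeierstrassCurve.bsdRHS_eq_of_isIsogenous` = `hCassels`; Milne *ADT*
I.7.3). Hence the TRANSPORT LEMMA, class-free:

* `N10.bsdp_of_isIsogenous_of_bsdp`, `N10.missingLowerBoundAt_of_isIsogenous_of_bsdp` (§1): if
  SOME `ℚ`-isogenous globally minimal `E'` satisfies `BSD(E',p)`, then `BSD(E,p)` and in particular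
  the lower half at `(E,p)` — whatever `ord_p #Ш_an(E)` is.

and its N10 instance on the rows where `BSD(E',p)` is a KERNEL THEOREM per pair, namely the
reducible semistable-twist rows (X3 ∧ (M) ∪ (G-ord, `e = 2`), `r_an = 0`, every odd `p`: chain of
record `ClassX3.bsdp_rankZero_of_subSemistableTwist_of_shaAn_unit`, four named facts, NO image /
Tamagawa / Manin / certificate input beyond `p ∤ #Ш_an(E')`):

* **`N10.bsdp_rankZero_classX3_of_isIsogenous_shaAn_unit`** (§2): X3 ∧ `p ≠ 2` ∧ `r_an = 0` ∧
  `SubSemistableTwist` holding for an isogenous `E'` with `ord_p #Ш_an(E') = 0` ⟹ `BSD(E,p)` (and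
  the lower half at `E`, `…missingLowerBoundAt…`). The cell predicates ARE isogeny-invariant
  (`ClassX3Gord.of_isIsogenous`, `subGord_iff_of_isIsogenous`, …, `Additive/GordIsogenyInvariance*`),
  but the theorem asks them of `E'` directly — decidable per pair by the census — so no invariance
  lemma is consumed.

CENSUS COLUMN this asks of the relations engine (cc-eng-3, `class-closure/relations/`; typer ask
T5): for every N10 content row `(E, p)` with `E[p]` REDUCIBLE (class X3), the minimum of
`ord_p #Ш_an` over the `ℚ`-isogeny class of `E` and a minimising curve `E'`; the row transports (is
CLOSED per pair by this file + the chain of record) iff that minimum is `0`. On X4 rows (irreducible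
`E[p]`) every `ℚ`-isogeny has degree prime to `p`, so `ord_p #Ш_an` is constant on the class and the
transport is EMPTY there — said here so that nobody tabulates it. (Precedents in the cell: rmap-1's
N1″ "Cassels transport / residue = the pairs with `p ∣ #Ш_an` on every isogenous curve"; o1's
"min `v₂(Ш_an)` over every isogenous curve".) Nothing booked; no label changes.

References: J. W. S. Cassels, J. reine angew. Math. 217 (1965) [Cassels1965ArithmeticVIII]; J. S.
Milne, *Arithmetic Duality Theorems* (2006) Thm. I.7.3, Rem. I.7.4 [MilneADT2006]; R. L. Miller, LMS
J. Comput. Math. 14 (2011) §1, Def. 1.1 [Miller2011LMS]; D. Delbourgo, Compositio Math. 113 (1998)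
Prop. 4 [Delbourgo1998]; C. Wuthrich, Doc. Math. 19 (2014) Thm. 16 [Wuthrich2014]; A. W. Knapp,
*Elliptic Curves* (1992) Thm. 11.67 [Knapp1993].
-/

noncomputable section

open scoped Classical

open WeierstrassCurve Literature.NumberTheory.EllipticCurves
  Literature.NumberTheory.EllipticCurves.ModularForms
  Literature.NumberTheory.EllipticCurves.Rank1Residual
  Literature.NumberTheory.EllipticCurves.Rank1Residual.Typed

namespace Summit.BirchSwinnertonDyer.Rank1Residual.Additive

/-! ## §1 The class-free transport: `BSD(E',p)` for an isogenous `E'` ⟹ `BSD(E,p)` ⟹ the lower half -/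

section Transport

variable {W W' : WeierstrassCurve ℚ} [W.IsElliptic] [W'.IsElliptic] [W.IsGloballyMinimal]
  [W'.IsGloballyMinimal] (p : ℕ) [Fact p.Prime]

/-- **Isogeny transport of `BSD(E,p)` in analytic rank `≤ 1`** (Cassels `hCassels`; GZK `hGZK` for the
finiteness of `Ш(E')`; modularity `hmod` for `L^{(r)}(E',1) ≠ 0`; the analytic rank is an isogeny
invariant unconditionally, `analyticRank_eq_of_isIsogenous'`). A thin wrapper of
`Wuthrich2014.bsdp_of_isIsogenous` with the cell's standing binders.
[cite: MilneADT2006, Thm. I.7.3 and Remark I.7.4] [cite: Miller2011LMS, §1 (arXiv:1010.2431 p. 3)] -/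
theorem N10.bsdp_of_isIsogenous_of_bsdp (hCassels : bsdRHS_eq_of_isIsogenous)
    (hGZK : rank_eq_analyticRank_of_analyticRank_le_one) (hmod : hasEntireLFunction_rat)
    (hiso : IsIsogenous W W') (hr : W.analyticRank ≤ 1) (h' : BSDp W' p) : BSDp W p := by
  have hr' : W'.analyticRank ≤ 1 := by rwa [← analyticRank_eq_of_isIsogenous' hiso]
  obtain ⟨-, hfin'⟩ := hGZK W' hr'
  exact Wuthrich2014.bsdp_of_isIsogenous hCassels hiso hfin'
    (WeierstrassCurve.leadingLCoeff_ne_zero_holds (hmod W')) h'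

/-- **Isogeny transport of the LOWER half**: `BSD(E',p)` for some isogenous `E'` gives the lower half
`ord_p #Ш_an(E) ≤ ord_p #Ш(E)` at `(E, p)` — whatever `ord_p #Ш_an(E)` is (the `p`-part of `#Ш_an`
is NOT an isogeny invariant; `BSD(E,p)` is). [cite: MilneADT2006, Thm. I.7.3] [cite: Miller2011LMS, Def. 1.1] -/
theorem N10.missingLowerBoundAt_of_isIsogenous_of_bsdp (hCassels : bsdRHS_eq_of_isIsogenous)
    (hGZK : rank_eq_analyticRank_of_analyticRank_le_one) (hmod : hasEntireLFunction_rat)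
    (hiso : IsIsogenous W W') (hr : W.analyticRank ≤ 1) (h' : BSDp W' p) :
    MissingLowerBoundAt W p := by
  haveI : Finite W.sha := (hGZK W hr).2
  exact (lower_and_upper_of_missingPPartAt W p
    (missingPPartAt_of_bsdp W p (N10.bsdp_of_isIsogenous_of_bsdp p hCassels hGZK hmod hiso hr h'))).1

end Transport

/-! ## §2 The N10 instance: reducible semistable-twist rows, `r_an = 0`, every odd `p` -/

section ClassX3

variable {W W' : WeierstrassCurve ℚ} [W.IsElliptic] [W'.IsElliptic] [W.IsGloballyMinimal]
  [W'.IsGloballyMinimal] (p : ℕ) [hp : Fact p.Prime]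

/-- **E3 isogeny transport on N10 ∩ X3: `BSD(E,p)` from ONE isogenous curve with `p ∤ #Ш_an`.** Let
`E ∼ E'` be `ℚ`-isogenous globally minimal curves, `p ≠ 2`, with `E'` of class X3 at `p` (additive,
`E'[p]` reducible), analytic rank `0`, in the census cell "semistable twist" ((M) ∪ (G-ord, `e = 2`)),
and `#Ш_an(E') = q'` a `p`-adic unit. Then `BSD(E',p)` holds by the X3 chain of record
(`ClassX3.bsdp_rankZero_of_subSemistableTwist_of_shaAn_unit`: Delbourgo 1998 Prop. 4 `hDel`, modular
parametrisation data `hmodD`, Wuthrich 2014 Thm. 16 half-eigen `hW16`, Wuthrich component `hWu`, GZK,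
modularity), hence `BSD(E,p)` by Cassels (`hCassels`) — also when `p ∣ #Ш_an(E)`, i.e. on a CONTENT
row of N10's lower-half conjecture. Per pair; nothing booked.
[cite: Delbourgo1998, Prop. 4 (p. 144)] [cite: Wuthrich2014, Thm. 16 (p. 397)]
[cite: MilneADT2006, Thm. I.7.3] [cite: Miller2011LMS, §1 and Def. 1.1] -/
theorem N10.bsdp_rankZero_classX3_of_isIsogenous_shaAn_unit
    (hCassels : bsdRHS_eq_of_isIsogenous)
    (hDel : Delbourgo1998.prop4_rankZero_pow_dvd_constantCoeff)
    (hGZK : rank_eq_analyticRank_of_analyticRank_le_one) (hmod : hasEntireLFunction_rat)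
    (hmodD : nonempty_modularParametrizationData)
    (hW16 : Wuthrich2014.thm16_halfEigenCharIdeal_dvd_cyclotomicPrime)
    (hWu : Wuthrich2014.charIdeal_dvd_padicLFunctionBranch_component)
    (hiso : IsIsogenous W W') (hp2 : p ≠ 2) (hX' : ClassX3 W' p) (hr' : W'.analyticRank = 0)
    (hS' : SubSemistableTwist W' p) {q' : ℚ} (hq' : shaAn W' = (q' : ℂ))
    (hv' : padicValRat p q' = 0) : BSDp W p :=
  N10.bsdp_of_isIsogenous_of_bsdp p hCassels hGZK hmod hiso
    (by rw [analyticRank_eq_of_isIsogenous' hiso, hr']; exact zero_le_one)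
    (ClassX3.bsdp_rankZero_of_subSemistableTwist_of_shaAn_unit W' p hDel hGZK hmod hmodD hW16 hWu hp2
      hX' hr' hS' hq' hv')

/-- The same transport read as the LOWER half at `(E, p)` (the N10 conjecture's content at the row).
[cite: Delbourgo1998, Prop. 4 (p. 144)] [cite: Wuthrich2014, Thm. 16 (p. 397)] [cite: MilneADT2006, Thm. I.7.3] -/
theorem N10.missingLowerBoundAt_rankZero_classX3_of_isIsogenous_shaAn_unit
    (hCassels : bsdRHS_eq_of_isIsogenous)
    (hDel : Delbourgo1998.prop4_rankZero_pow_dvd_constantCoeff)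
    (hGZK : rank_eq_analyticRank_of_analyticRank_le_one) (hmod : hasEntireLFunction_rat)
    (hmodD : nonempty_modularParametrizationData)
    (hW16 : Wuthrich2014.thm16_halfEigenCharIdeal_dvd_cyclotomicPrime)
    (hWu : Wuthrich2014.charIdeal_dvd_padicLFunctionBranch_component)
    (hiso : IsIsogenous W W') (hp2 : p ≠ 2) (hX' : ClassX3 W' p) (hr' : W'.analyticRank = 0)
    (hS' : SubSemistableTwist W' p) {q' : ℚ} (hq' : shaAn W' = (q' : ℂ))
    (hv' : padicValRat p q' = 0) : MissingLowerBoundAt W p :=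
  N10.missingLowerBoundAt_of_isIsogenous_of_bsdp p hCassels hGZK hmod hiso
    (by rw [analyticRank_eq_of_isIsogenous' hiso, hr']; exact zero_le_one)
    (ClassX3.bsdp_rankZero_of_subSemistableTwist_of_shaAn_unit W' p hDel hGZK hmod hmodD hW16 hWu hp2
      hX' hr' hS' hq' hv')

/-- Bookkeeping for the relations table: the hypotheses asked of the isogenous curve `E'` in
`N10.bsdp_rankZero_classX3_of_isIsogenous_shaAn_unit` (class X3, odd `p`, semistable-twist cell) place
`E'` in the N10 locus — the partner is looked for INSIDE class N10, not in a closed class. [folklore] -/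
theorem N10.locus_of_classX3_of_subSemistableTwist (hp2 : p ≠ 2) (hX' : ClassX3 W' p)
    (hS' : SubSemistableTwist W' p) : N10.Locus W' p :=
  (N10.locus_iff_cells W' p).mpr
    ((N10.cellM_or_cellGordTwo_of_classX3_of_subSemistableTwist W' p hp2 hX' hS').elim Or.inl
      fun h ↦ Or.inr (Or.inl h))

end ClassX3

end Summit.BirchSwinnertonDyer.Rank1Residual.Additive

end
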